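import Literature.Topology.FourManifolds.EmbeddingGerms
import Mathlib.LinearAlgebra.Determinant
import Mathlib.Analysis.Normed.Module.FiniteDimension
import HarnessLib

/-!
# Parametrisations of compact pieces by embedding germs and their isotopy classes
# (Cerf 1968, Ch. III §1 and Ch. IV §3: the spaces `ℰ_k` of orientation-preserving embeddings of
# the models `M_k`, the groups `𝒢_k`, and the classes `ℰ_k/𝒢_{k;e}`)

Topic `Literature/Topology/FourManifolds` (programme of the fact
`Literature.Topology.FourManifolds.cerf_pi0DiffDisc_relBoundary_three`, brick C3, objects).  Cerf's `ℰ_k` is the space of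
orientation-preserving embeddings of the model `M_k ⊆ ℝ³` (a compact piece with corners) into
`ℝ³`, `𝒢_k` the group of orientation-preserving diffeomorphisms of `M_k`, and `ℛ_k` is built
from the classes of `ℰ_k` modulo the identity component `𝒢_{k;e}`.  In the tree (no topology on
mapping spaces) an element of `ℰ_k` with image `A` is an **orientation-preserving embedding germ**
of the compact set `M` with `f '' M = A` (`IsPiecePar M A f`, over `EmbeddingGerms.IsEmbGerm`;
Cerf's "plongements fidèles", Ch. III §2, are exactly the germ-extendable ones), the identity
component of `𝒢_k` is replaced by **smooth isotopies of `M` in itself** (`IsSelfIsotopy M K`: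
a jointly smooth family of embedding germs of `M` onto itself starting at the identity), and two
parametrisations are in the same class when they differ by the end of such an isotopy
(`IsoRel M f f'`).  This file proves that `IsoRel M` is an equivalence relation on the
parametrisations of each piece (symmetry by the inverse family of
`IsEmbGerm.exists_inverse_family`, transitivity by stagewise composition) and that it is
natural under post-composition with ambient embedding germs (`IsoRel.postcomp`), which is how
classes are transported along ambient families.

## References
* [CerfDiffeoSphere1968] J. Cerf, *Sur les difféomorphismes de la sphère de dimension trois
  (Γ₄ = 0)*, LNM 53 (1968), Ch. III §1–2; Ch. IV §3.
-/

noncomputable section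

open Set Function Filter Topology
open scoped ContDiff

namespace Literature.Topology.FourManifolds

variable {E : Type*} [NormedAddCommGroup E] [NormedSpace ℝ E] [FiniteDimensional ℝ E]

/-! ### Orientation-preserving embedding germs of a piece onto a set -/

/-- **A parametrisation of the piece `A` by the model `M`**: an embedding germ along `M`
(`IsEmbGerm`), orientation preserving on `M` (positive Jacobian determinant), with
`f '' M = A` — an element of Cerf's `ℰ_k` with image `A`, in germ form.
[cite: CerfDiffeoSphere1968, Ch. III §1 (`ℰ_k`) and §2 (plongements fidèles)] -/
structure IsPiecePar (M A : Set E) (f : E → E) : Prop where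
  /-- The map is an embedding germ along `M`. -/
  isEmbGerm : IsEmbGerm M f
  /-- Positive Jacobian determinant on `M`. -/
  det_pos : ∀ x ∈ M, 0 < LinearMap.det (fderiv ℝ f x : E →ₗ[ℝ] E)
  /-- The image of the model is the piece. -/
  image_eq : f '' M = A

/-- **A smooth isotopy of the model `M` in itself, starting at the identity** (a smooth path in
Cerf's `𝒢_k` issued from `e`, in germ form): jointly smooth, every stage in `[0, 1]` an
embedding germ of `M` onto `M`, stage `0` the identity on `M`.
[cite: CerfDiffeoSphere1968, Ch. IV §3 (`𝒢_{k;e}`)] -/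
structure IsSelfIsotopy (M : Set E) (K : ℝ → E → E) : Prop where
  /-- Joint smoothness. -/
  contDiff : ContDiff ℝ ∞ (uncurry K)
  /-- Every stage is an embedding germ along `M`. -/
  isEmbGerm : ∀ t ∈ Icc (0 : ℝ) 1, IsEmbGerm M (K t)
  /-- Every stage maps `M` onto `M`. -/
  image_eq : ∀ t ∈ Icc (0 : ℝ) 1, K t '' M = M
  /-- Stage `0` is the identity on `M`. -/
  zero_apply : ∀ x ∈ M, K 0 x = x

/-- **The class relation**: `f'` is obtained from `f` by an isotopy of the model,
`f' = f ∘ K₁` on `M` (Cerf's classes `ℰ_k / 𝒢_{k;e}`).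
[cite: CerfDiffeoSphere1968, Ch. IV §3] -/
def IsoRel (M : Set E) (f f' : E → E) : Prop :=
  ∃ K : ℝ → E → E, IsSelfIsotopy M K ∧ ∀ x ∈ M, f' x = f (K 1 x)

namespace IsSelfIsotopy

variable {M : Set E} {K K' : ℝ → E → E}

omit [FiniteDimensional ℝ E] in
/-- The constant isotopy. [folklore] -/
theorem refl (M : Set E) : IsSelfIsotopy M (fun _ x => x) :=
  ⟨contDiff_snd, fun _ _ => IsEmbGerm.id M, fun _ _ => image_id M, fun _ _ => rfl⟩

omit [FiniteDimensional ℝ E] in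
/-- Each stage of a self-isotopy is smooth. [folklore] -/
theorem contDiff_stage (h : IsSelfIsotopy M K) (t : ℝ) : ContDiff ℝ ∞ (K t) := by
  have h1 := h.contDiff.comp (contDiff_const.prodMk contDiff_id : ContDiff ℝ ∞ fun x : E => ((t, x) : ℝ × E))
  exact h1

omit [FiniteDimensional ℝ E] in
/-- Stages of a self-isotopy map points of `M` into `M`. [folklore] -/
theorem mapsTo (h : IsSelfIsotopy M K) {t : ℝ} (ht : t ∈ Icc (0 : ℝ) 1) : MapsTo (K t) M M := by
  intro x hx
  have h1 : K t x ∈ K t '' M := mem_image_of_mem _ hx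
  rwa [h.image_eq t ht] at h1

omit [FiniteDimensional ℝ E] in
/-- **Stagewise composition** of self-isotopies is a self-isotopy. [folklore] -/
theorem comp (h : IsSelfIsotopy M K) (h' : IsSelfIsotopy M K') :
    IsSelfIsotopy M (fun t x => K t (K' t x)) := by
  refine ⟨?_, fun t ht => ?_, fun t ht => ?_, fun x hx => ?_⟩
  · have h1 := h.contDiff.comp (contDiff_fst.prodMk h'.contDiff :
      ContDiff ℝ ∞ fun q : ℝ × E => ((q.1, K' q.1 q.2) : ℝ × E))
    exact h1
  · have hg : IsEmbGerm (K' t '' M) (K t) := by rw [h'.image_eq t ht]; exact h.isEmbGerm t ht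
    exact hg.comp (h'.isEmbGerm t ht)
  · show (K t ∘ K' t) '' M = M
    rw [image_comp, h'.image_eq t ht, h.image_eq t ht]
  · show K 0 (K' 0 x) = x
    rw [h'.zero_apply x hx, h.zero_apply x hx]

/-- **Inverse self-isotopy**: for a self-isotopy of a compact `M` there is a self-isotopy `G`
with `G t (K t x) = x` and `K t (G t x) = x` for `x ∈ M`, `t ∈ [0, 1]`. [folklore] -/
theorem exists_inverse (hM : IsCompact M) (h : IsSelfIsotopy M K) :
    ∃ G : ℝ → E → E, IsSelfIsotopy M G ∧ (∀ t ∈ Icc (0 : ℝ) 1, ∀ x ∈ M, G t (K t x) = x) ∧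
      (∀ t ∈ Icc (0 : ℝ) 1, ∀ x ∈ M, K t (G t x) = x) := by
  obtain ⟨G, hGs, hleft, hright, hGg⟩ := IsEmbGerm.exists_inverse_family isCompact_Icc hM h.contDiff
    (fun t ht x hx => (h.isEmbGerm t ht).isInvertible x hx) (fun t ht => (h.isEmbGerm t ht).injOn)
  have hl : ∀ t ∈ Icc (0 : ℝ) 1, ∀ x ∈ M, G t (K t x) = x := fun t ht x hx => by
    have h1 : ∀ᶠ q : ℝ × E in 𝓝 ((t, x) : ℝ × E), G q.1 (K q.1 q.2) = q.2 :=
      hleft.filter_mono (nhds_le_nhdsSet (show ((t, x) : ℝ × E) ∈ Icc (0:ℝ) 1 ×ˢ M from ⟨ht, hx⟩))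
    exact h1.self_of_nhds
  have hr : ∀ t ∈ Icc (0 : ℝ) 1, ∀ x ∈ M, K t (G t x) = x := fun t ht x hx => by
    -- `x = K t x'` with `x' ∈ M`
    obtain ⟨x', hx', rfl⟩ : x ∈ K t '' M := by rw [h.image_eq t ht]; exact hx
    rw [hl t ht x' hx']
  refine ⟨G, ⟨hGs, fun t ht => ?_, fun t ht => ?_, fun x hx => ?_⟩, hl, hr⟩
  · rw [← h.image_eq t ht]; exact hGg t ht
  · apply Subset.antisymm
    · rintro _ ⟨x, hx, rfl⟩
      obtain ⟨x', hx', rfl⟩ : x ∈ K t '' M := by rw [h.image_eq t ht]; exact hx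
      rw [hl t ht x' hx']; exact hx'
    · intro x hx
      exact ⟨K t x, h.mapsTo ht hx, hl t ht x hx⟩
  · have h0 := hl 0 ⟨le_rfl, zero_le_one⟩ x hx
    rwa [h.zero_apply x hx] at h0

end IsSelfIsotopy

namespace IsoRel

variable {M A : Set E} {f f' f'' : E → E}

omit [FiniteDimensional ℝ E] in
/-- Reflexivity. [folklore] -/
theorem refl (M : Set E) (f : E → E) : IsoRel M f f :=
  ⟨fun _ x => x, IsSelfIsotopy.refl M, fun _ _ => rfl⟩

/-- Symmetry (through the inverse isotopy). [folklore] -/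
theorem symm (hM : IsCompact M) (h : IsoRel M f f') : IsoRel M f' f := by
  obtain ⟨K, hK, hf⟩ := h
  obtain ⟨G, hG, hl, hr⟩ := hK.exists_inverse hM
  refine ⟨G, hG, fun x hx => ?_⟩
  rw [hf _ (hG.mapsTo ⟨zero_le_one, le_rfl⟩ hx), hr 1 ⟨zero_le_one, le_rfl⟩ x hx]

omit [FiniteDimensional ℝ E] in
/-- Transitivity (stagewise composition). [folklore] -/
theorem trans (h : IsoRel M f f') (h' : IsoRel M f' f'') : IsoRel M f f'' := by
  obtain ⟨K, hK, hf⟩ := h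
  obtain ⟨K', hK', hf'⟩ := h'
  refine ⟨fun t x => K t (K' t x), hK.comp hK', fun x hx => ?_⟩
  rw [hf' x hx, hf _ (hK'.mapsTo ⟨zero_le_one, le_rfl⟩ hx)]

omit [FiniteDimensional ℝ E] in
/-- **Naturality under post-composition**: related parametrisations stay related after
composition with any map (in particular with the stages of an ambient isotopy).
[folklore] -/
theorem postcomp (h : IsoRel M f f') (Θ : E → E) : IsoRel M (Θ ∘ f) (Θ ∘ f') := by
  obtain ⟨K, hK, hf⟩ := h
  exact ⟨K, hK, fun x hx => by simp only [comp_apply, hf x hx]⟩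

omit [FiniteDimensional ℝ E] in
/-- Relatedness only depends on the values on `M`. [folklore] -/
theorem congr (h : IsoRel M f f') {g g' : E → E} (hg : ∀ x ∈ M, g x = f x)
    (hg' : ∀ x ∈ M, g' x = f' x) : IsoRel M g g' := by
  obtain ⟨K, hK, hf⟩ := h
  exact ⟨K, hK, fun x hx => by rw [hg' x hx, hf x hx, hg _ (hK.mapsTo ⟨zero_le_one, le_rfl⟩ hx)]⟩

end IsoRel

namespace IsPiecePar

variable {M A B : Set E} {f g Θ : E → E}

omit [FiniteDimensional ℝ E] in
/-- The identity parametrises every piece by itself. [folklore] -/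
theorem id (M : Set E) : IsPiecePar M M (id : E → E) :=
  ⟨IsEmbGerm.id M, fun x _ => by rw [fderiv_id]; simp, image_id M⟩

omit [FiniteDimensional ℝ E] in
/-- **Post-composition with an orientation-preserving ambient germ** along the piece gives a
parametrisation of the image piece. [folklore] -/
theorem postcomp (hΘ : IsEmbGerm A Θ) (hΘdet : ∀ y ∈ A, 0 < LinearMap.det (fderiv ℝ Θ y : E →ₗ[ℝ] E))
    (hf : IsPiecePar M A f) : IsPiecePar M (Θ '' A) (Θ ∘ f) := by
  have hA : f '' M = A := hf.image_eq
  refine ⟨(hA ▸ hΘ).comp hf.isEmbGerm, fun x hx => ?_, by rw [image_comp, hA]⟩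
  have hdf : DifferentiableAt ℝ f x := hf.isEmbGerm.contDiff.differentiable (by simp) x
  have hdΘ : DifferentiableAt ℝ Θ (f x) := hΘ.contDiff.differentiable (by simp) (f x)
  rw [fderiv_comp x hdΘ hdf,
    show (((fderiv ℝ Θ (f x)).comp (fderiv ℝ f x) : E →L[ℝ] E) : E →ₗ[ℝ] E) =
      (fderiv ℝ Θ (f x) : E →ₗ[ℝ] E).comp (fderiv ℝ f x : E →ₗ[ℝ] E) from rfl, LinearMap.det_comp]
  exact mul_pos (hΘdet (f x) (hA ▸ mem_image_of_mem f hx)) (hf.det_pos x hx)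

omit [FiniteDimensional ℝ E] in
/-- **Pre-composition with the end of a self-isotopy of the model** gives a parametrisation of
the same piece, in the same class. [cite: CerfDiffeoSphere1968, Ch. IV §3] -/
theorem precomp_stage {K : ℝ → E → E} (hf : IsPiecePar M A f) (hK : IsSelfIsotopy M K)
    (hKdet : ∀ x ∈ M, 0 < LinearMap.det (fderiv ℝ (K 1) x : E →ₗ[ℝ] E)) :
    IsPiecePar M A (f ∘ K 1) ∧ IsoRel M f (f ∘ K 1) := by
  have h1 : (1 : ℝ) ∈ Icc (0 : ℝ) 1 := ⟨zero_le_one, le_rfl⟩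
  refine ⟨⟨?_, fun x hx => ?_, ?_⟩, ⟨K, hK, fun _ _ => rfl⟩⟩
  · have hg : IsEmbGerm (K 1 '' M) f := by rw [hK.image_eq 1 h1]; exact hf.isEmbGerm
    exact hg.comp (hK.isEmbGerm 1 h1)
  · have hdK : DifferentiableAt ℝ (K 1) x := (hK.contDiff_stage 1).differentiable (by simp) x
    have hdf : DifferentiableAt ℝ f (K 1 x) := hf.isEmbGerm.contDiff.differentiable (by simp) _
    rw [fderiv_comp x hdf hdK,
      show (((fderiv ℝ f (K 1 x)).comp (fderiv ℝ (K 1) x) : E →L[ℝ] E) : E →ₗ[ℝ] E) =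
        (fderiv ℝ f (K 1 x) : E →ₗ[ℝ] E).comp (fderiv ℝ (K 1) x : E →ₗ[ℝ] E) from rfl,
      LinearMap.det_comp]
    exact mul_pos (hf.det_pos _ (hK.mapsTo h1 hx)) (hKdet x hx)
  · rw [image_comp, hK.image_eq 1 h1, hf.image_eq]

end IsPiecePar

end Literature.Topology.FourManifolds
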